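import Summits.NavierStokesRegularity.NavierStokesRegularity.Theses.ClockStretchingLaw
import Summits.NavierStokesRegularity.NavierStokesRegularity.Theorems.ClockStretchingLawSteadySliceLiouville
import Summits.NavierStokesRegularity.NavierStokesRegularity.Theorems.SqueezeCycleExtremalElementExistsRescale
import Summits.NavierStokesRegularity.NavierStokesRegularity.Theorems.ClockStretchingLawClockLawStubTimeDerivBounds
import Summits.NavierStokesRegularity.NavierStokesRegularity.Theorems.ClockStretchingLawClockLawStubClockSlice
import Summits.NavierStokesRegularity.NavierStokesRegularity.Theorems.ClockStretchingLawClockLawStubZoomExtraction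
import Summits.NavierStokesRegularity.NavierStokesRegularity.Theorems.ClockStretchingLawClockLawStubLimitSingular
import Summits.NavierStokesRegularity.NavierStokesRegularity.Theorems.ClockStretchingLawClockLawStubClassPressure
import Literature.Analysis.FluidPDE.TypeIAncientMild
import Literature.Analysis.FluidPDE.LocalTypeI
import Literature.Analysis.FluidPDE.NormalisedPressure
import Literature.Analysis.FluidPDE.BallCutoff

/-!
# Skeleton for crux `ClockStretchingLaw.ClockLaw` (stmt-NavierStokesRegularity-10571), line `birth`
# — lead revision r2 (prover-line-stmt-NavierStokesRegularity-10571-c1-0, 2026-08-17)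

r2 (after wave 1): stubs 1, 2, 3, 7 are LANDED (`…Theorems/ClockStretchingLawClockLawStub{TimeDerivBounds,
ClockSlice,ZoomExtraction,LimitSingular}.lean`, p148023 / p148155 / p147751 / p147016) and are
discharged below by the landed theorems; the stub-6 worker found that the tree's SqueezeCycle item
`SingularProfileOfNontrivial` already identifies and bounds the pressure of a Type-I KNSS-mild field
(`exists_isClassicalNSSolutionOn_Iio_of_isTypeIAncientMild`, `SingularProfile.pressure_eq_pressurePotential_add`,
`exists_cknDOsc_unit_bound`), so `ClassPressure` holds UNCONDITIONALLY and the former stubs 4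
(`stub_duhamelPressure`) and 5 (`stub_pressureRepr`) are no longer load-bearing: they are DROPPED from
the stub set. All five remaining stubs are landed (`stub_classPressure : ClassPressure` as
`ClockLaw.Birth.classPressure_holds`, p148736): the file has NO `sorry`; the sorry-free assembly is
landed separately as `Theorems/ClockStretchingLawClockLaw.lean` (`clockStretchingLaw_clockLaw_proof`).
The r1 text below is kept for the record.

**The clock cannot stop**: if an element `u` of the route's Type-I model class `𝒦_C` (smooth,
divergence-free, KNSS-mild ancient field on `ℝ³ × (−∞,0)` with `‖u‖ ≤ C/√(−t)` and scale-invariant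
local energies `A, E ≤ C`) is SINGULAR at the space-time origin, then its CLOCK AMPLITUDE
`a_u(t) = (−t)^{3/2} ∫ ‖∂ₜu(t,x)‖² e^{−‖x‖²/(4(−t))} dx` is bounded below on `[−1, 0)`.

## The line (unchanged idea): CONTINUITY · NO STEADY INSTANT · PERSISTENCE UNDER THE PARABOLIC ZOOM

The planner's three statements `ClockContinuous`, `SteadyOfClockZero`, `ZoomPersistence` are
kept and still compose to `ClockLaw` exactly as in the registered skeleton (`clockLaw_of_three`,
compactness of `[−1,0]`). What the lead changes (r1) is the STUB SET: the size-L stub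
`stub_zoomPersistence` hid (a) an extraction, (b) a persistence-of-singularities argument that
needs a PRESSURE for elements of `𝒦_C` with an `L^{3/2}(Q₁)` bound depending only on `C`
(the crux's recorded "why it might fail", AB2019 Rem. 3.2), and (c) the convergence of the clock
amplitudes; and all three planner stubs need time-derivative bounds for KNSS-mild fields. The
seven registered stubs below are each one worker's job and compose (kernel-checked here) to the
three planner statements and hence to the crux BY NAME:

* `stub_timeDerivBounds : TimeDerivBounds` — UNIVERSAL window bounds on `∂ₜu`, `∂ₜ²u` for all
  Type-I KNSS-mild fields with the same constant (KNSS 2009 Prop. 4.1 in its quantitative local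
  form `knss2009_local_smoothing_holds` + uniqueness of bounded Oseen solutions).
* `stub_clockSlice : ClockSlice` — GIVEN `TimeDerivBounds`: continuity of `t ↦ a_u(t)` on
  `(−∞,0)`, a zero of the clock is a steady instant, the clock amplitudes converge along
  pointwise-convergent sequences in the class, and the parabolic covariance
  `a_{u_c}(s) = a_u(c²s)` of the amplitude under the zoom `u_c(s,y) = c u(c²s, cy)`.
* `stub_zoomExtraction : ZoomExtraction` — along any positive scales `c_n` the zooms of an element
  of the class (Type-I mild + energy ledger) converge pointwise, along a subsequence, to an element
  of the class with the SAME constant (`exists_tendsto_of_typeI_seq_Ioo`,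
  `energyBounds_of_tendsto_Ioo`, scale invariance of the ledger).
* `stub_duhamelPressure : DuhamelPressure` — THE LINEAR PRESSURE LEMMA: for a smooth, bounded field
  `V` with uniformly compact spatial support, the Oseen–Duhamel term `D = B¹_s(V,V)` and the Riesz
  pressure `q(t) = p̃[V(t)]` (`normalisedPressure`) solve the Stokes system with tensor `V ⊗ V` in
  the sense of distributions on the slab: `∫∫ ⟪D, ∂ₜψ⟫ + ⟪D, Δψ⟫ = ∫∫ ⟪V, (V·∇)ψ⟫ + q div ψ`.
* `stub_pressureRepr : DuhamelPressure → PressureRepr` — the PRESSURE OF A TYPE-I MODEL on the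
  cylinder `Q(0,2)`: `(u, p)` is a distributional solution there with
  `|p − p̃[χu(t)]| ≤ K₀ C` (`χ = ballCutoff 0 2`; near field by the linear lemma applied to `χu`,
  far field of the Duhamel term vanishing in the limit of large cut-offs, far-field pressure
  bounded by the scaled energy `A ≤ C` on dyadic shells).
* `stub_classPressure : PressureRepr → ClassPressure` — suitability in `Q(0,1)` (bounded
  distributional solutions are suitable + exhaustion) and the UNIFORM bound
  `‖u‖_{L³(Q₁)} + ‖p‖_{L^{3/2}(Q₁)} ≤ K(C)` (interpolation `C ≤ C₀(A+E)^{3/2}`, Stein's bound).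
* `stub_limitSingular : ClassPressure → LimitSingular` — a pointwise limit of zooms of a SINGULAR
  element is singular at the origin (`unbounded_at_origin_of_zoomIn_limit`: A–B Lemma 2.2 +
  Prop. 2.3, both proved in the tree; each zoom is in `𝒦_C`, hence suitable with the uniform bound).

Composition (all proved below, no `sorry` outside the seven stubs): `inTypeIClass_iff` (the
route's inline class = `IsTypeIAncientMild C u ∧ EnergyLedger C u`); `clockContinuous_of`,
`steadyOfClockZero_of` (from stubs 1–2); `zoomPersistence_of` (from stubs 1–7: scales
`c_n = √(−t_n)`, extraction, singular limit, covariance `a_u(t_{φ n}) = a_{u_{c_{φ n}}}(−1)`,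
convergence); `clockLaw_of_three` (the registered compactness argument); `ClockLaw_of`.
-/

noncomputable section

set_option linter.dupNamespace false

namespace Summit.NavierStokesRegularity.NavierStokesRegularity.Cruxes.ClockLaw.Birth

open MeasureTheory Filter Topology Set
open Summit.NavierStokesRegularity.NavierStokesRegularity.Theses.ClockStretchingLaw

/-- Local notation: `ℝ³`. -/
local notation "E3" => EuclideanSpace ℝ (Fin 3)

/-! ## Vocabulary (definitional abbreviations of the crux's own clauses) -/

/-- **The route's Type-I model class `𝒦_C`** — VERBATIM the antecedent of `ClockLaw`. -/
def InTypeIClass (C : ℝ) (u : ℝ → E3 → E3) : Prop :=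
  ContDiffOn ℝ (⊤ : ℕ∞) (Function.uncurry u) (Set.Iio 0 ×ˢ Set.univ) ∧ (∀ t < 0, Literature.Analysis.FluidPDE.VectorCalculus.IsDivFree (u t)) ∧ (∀ s t : ℝ, s < t → t < 0 → ∀ x, u t x = Literature.Analysis.FluidPDE.heatFlow (u s) (t - s) x - ∫ τ in Set.Ioo s t, ∫ y, ((-(inner ℝ (x - y) (u τ y) / (2 * (t - τ)) * Literature.Analysis.UnboundedOperators.heatKernel (t - τ) (x - y))) • u τ y + (∫ σ in Set.Ioi (t - τ), Literature.Analysis.UnboundedOperators.heatKernel σ (x - y) / (4 * σ ^ 2)) • (inner ℝ (x - y) (u τ y) • u τ y + inner ℝ (u τ y) (u τ y) • (x - y) + inner ℝ (x - y) (u τ y) • u τ y) - ((∫ σ in Set.Ioi (t - τ), Literature.Analysis.UnboundedOperators.heatKernel σ (x - y) / (8 * σ ^ 3)) * (inner ℝ (x - y) (u τ y) * inner ℝ (x - y) (u τ y))) • (x - y))) ∧ Literature.Analysis.FluidPDE.HasTypeITimeDecay C u ∧ (∀ (x₀ : EuclideanSpace ℝ (Fin 3)) (t₀ r : ℝ), t₀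 ≤ 0 → 0 < r → (∀ t, t₀ - r ^ 2 < t → t < t₀ → r⁻¹ * ∫ x in Metric.ball x₀ r, ‖u t x‖ ^ 2 ≤ C) ∧ r⁻¹ * ∫ t in Set.Ioo (t₀ - r ^ 2) t₀, ∫ x in Metric.ball x₀ r, ‖fderiv ℝ (u t) x‖ ^ 2 ≤ C)

/-- **The energy ledger** `A, E ≤ C` on every backward parabolic cylinder with vertex time `≤ 0` —
VERBATIM the fifth conjunct of the class. -/
def EnergyLedger (C : ℝ) (u : ℝ → E3 → E3) : Prop :=
  ∀ (x₀ : EuclideanSpace ℝ (Fin 3)) (t₀ r : ℝ), t₀ ≤ 0 → 0 < r → (∀ t, t₀ - r ^ 2 < t → t < t₀ → r⁻¹ * ∫ x in Metric.ball x₀ r, ‖u t x‖ ^ 2 ≤ C) ∧ r⁻¹ * ∫ t in Set.Ioo (t₀ - r ^ 2) t₀, ∫ x in Metric.ball x₀ r, ‖fderiv ℝ (u t) x‖ ^ 2 ≤ C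

/-- **Singular at the space-time origin** — VERBATIM the crux's second antecedent. -/
def IsSingularAtOrigin (u : ℝ → E3 → E3) : Prop :=
  ∀ r > 0, ∀ M : ℝ, ∃ t ∈ Set.Ioo (-(r ^ 2)) (0 : ℝ), ∃ x ∈ Metric.ball (0 : EuclideanSpace ℝ (Fin 3)) r, M < ‖u t x‖

/-- **The clock amplitude** `a_u(t) = (−t)^{3/2} ∫ ‖∂ₜu(t,x)‖² e^{−‖x‖²/(4(−t))} dx` — VERBATIM the
right-hand side of the crux's conclusion. -/
def clockAmp (u : ℝ → E3 → E3) (t : ℝ) : ℝ :=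
  (-t) ^ ((3 : ℝ) / 2) * ∫ x, ‖Literature.Analysis.FluidPDE.timeDeriv u t x‖ ^ 2 * Real.exp (-(‖x‖ ^ 2) / (4 * (-t)))

/-- **The vocabulary is DEFINITIONALLY the crux.** -/
theorem clockLaw_iff :
    ClockLaw ↔ ∀ (C : ℝ) (u : ℝ → E3 → E3), InTypeIClass C u → IsSingularAtOrigin u →
      ∃ δ > 0, ∀ t : ℝ, -1 ≤ t → t < 0 → δ ≤ clockAmp u t :=
  Iff.rfl

/-- The route's inline class is the tree's Type-I KNSS-mild class plus the energy ledger (the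
written-out double integral is `oseenDuhamel 1 s u u t x`, definitional unfolding of
`oseenKernel`/`oseenWeightA`/`oseenWeightB`). -/
theorem inTypeIClass_iff {C : ℝ} {u : ℝ → E3 → E3} :
    InTypeIClass C u ↔ Literature.Analysis.FluidPDE.IsTypeIAncientMild C u ∧ EnergyLedger C u := by
  rw [Literature.Analysis.FluidPDE.isTypeIAncientMild_iff]
  constructor
  · rintro ⟨h1, h2, h3, h4, h5⟩
    refine ⟨⟨h1, h2, fun s t hst ht x => ?_, h4⟩, h5⟩
    rw [h3 s t hst ht x]
    rfl
  · rintro ⟨⟨h1, h2, h3, h4⟩, h5⟩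
    refine ⟨h1, h2, fun s t hst ht x => ?_, h4, h5⟩
    rw [h3 s t hst ht x]
    rfl

/-- Projection: an element of `𝒦_C` is a Type-I KNSS-mild field. -/
theorem InTypeIClass.isTypeIAncientMild {C : ℝ} {u : ℝ → E3 → E3} (h : InTypeIClass C u) :
    Literature.Analysis.FluidPDE.IsTypeIAncientMild C u :=
  (inTypeIClass_iff.1 h).1

/-- Projection: the energy ledger of an element of `𝒦_C`. -/
theorem InTypeIClass.energy {C : ℝ} {u : ℝ → E3 → E3} (h : InTypeIClass C u) : EnergyLedger C u :=
  (inTypeIClass_iff.1 h).2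

/-! ## The three planner statements (kept; now CONSEQUENCES of the stubs) -/

/-- **S1 — THE CLOCK AMPLITUDE IS CONTINUOUS IN TIME** on `(−∞, 0)` along every element of `𝒦_C`. -/
def ClockContinuous : Prop :=
  ∀ (C : ℝ) (u : ℝ → E3 → E3), InTypeIClass C u → ContinuousOn (clockAmp u) (Set.Iio 0)

/-- **S2 — A ZERO OF THE CLOCK IS A STEADY INSTANT**. -/
def SteadyOfClockZero : Prop :=
  ∀ (C : ℝ) (u : ℝ → E3 → E3), InTypeIClass C u → ∀ t < 0, clockAmp u t = 0 →
    ∀ x, Literature.Analysis.FluidPDE.timeDeriv u t x = 0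

/-- **S3 — PERSISTENCE UNDER THE PARABOLIC ZOOM**. -/
def ZoomPersistence : Prop :=
  ∀ (C : ℝ) (u : ℝ → E3 → E3), InTypeIClass C u → IsSingularAtOrigin u →
    ∀ t : ℕ → ℝ, (∀ n, -1 ≤ t n ∧ t n < 0) → Tendsto t atTop (𝓝 0) →
      ∃ (C' : ℝ) (v : ℝ → E3 → E3), InTypeIClass C' v ∧ IsSingularAtOrigin v ∧
        ∃ φ : ℕ → ℕ, StrictMono φ ∧
          Tendsto (fun n => clockAmp u (t (φ n))) atTop (𝓝 (clockAmp v (-1)))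

/-! ## The seven stub statements (r1) -/

/-- **Stub statement 1 — UNIVERSAL TIME-DERIVATIVE BOUNDS ON WINDOWS.** For every constant `C`
and every compact window `[a, b] ⊂ (−∞, 0)` there is `K = K(C, a, b)` bounding `‖∂ₜu(t,x)‖` and
`‖∂ₜ²u(t,x)‖` for ALL Type-I KNSS-mild fields `u` with constant `C`, all `t ∈ [a,b]`, all `x`
(KNSS 2009 Prop. 4.1 / (4.10) with `l = 1, 2`: `knss2009_local_smoothing_holds` restarted at
`s = t − h` with the universal window `h = ε/M²`, `M = C/√(−b/2) + 1`, and uniqueness of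
bounded Oseen solutions `oseenMild_bounded_unique`, as in `analyticOnNhd_uncurry_of_oseenMild`). -/
def TimeDerivBounds : Prop :=
  ∀ (C a b : ℝ), a < b → b < 0 → ∃ K : ℝ,
    ∀ u : ℝ → E3 → E3, Literature.Analysis.FluidPDE.IsTypeIAncientMild C u →
      ∀ t ∈ Set.Icc a b, ∀ x : E3,
        ‖Literature.Analysis.FluidPDE.timeDeriv u t x‖ ≤ K ∧
          ‖iteratedDeriv 2 (fun s : ℝ => u s x) t‖ ≤ K

/-- **Stub statement 2 — CLOCK CALCULUS ON SLICES**, given the time-derivative bounds: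
(i) `t ↦ a_u(t)` is continuous on `(−∞,0)` (dominated convergence, Gaussian majorant);
(ii) `a_u(t₀) = 0` at `t₀ < 0` forces `∂ₜu(t₀,·) ≡ 0` (continuous nonnegative INTEGRABLE integrand);
(iii) clock amplitudes converge along pointwise-convergent sequences of the class with a common
constant (second-derivative bound ⇒ convergence of first time derivatives; dominated convergence);
(iv) the parabolic covariance `a_{u_c}(s) = a_u(c²s)` of the amplitude under the zoom
`u_c = c • stPull (c²) c 0 0 u`, `u_c(s,y) = c u(c²s, cy)` (chain rule, substitution `x = cy`). -/
def ClockSlice : Prop :=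
  TimeDerivBounds →
    (∀ (C : ℝ) (u : ℝ → E3 → E3), Literature.Analysis.FluidPDE.IsTypeIAncientMild C u →
        ContinuousOn (clockAmp u) (Set.Iio 0)) ∧
    (∀ (C : ℝ) (u : ℝ → E3 → E3), Literature.Analysis.FluidPDE.IsTypeIAncientMild C u →
        ∀ t < 0, clockAmp u t = 0 → ∀ x, Literature.Analysis.FluidPDE.timeDeriv u t x = 0) ∧
    (∀ (C : ℝ) (w : ℕ → ℝ → E3 → E3) (W : ℝ → E3 → E3),
        (∀ j, Literature.Analysis.FluidPDE.IsTypeIAncientMild C (w j)) →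
        Literature.Analysis.FluidPDE.IsTypeIAncientMild C W →
        (∀ t < 0, ∀ x, Tendsto (fun j => w j t x) atTop (𝓝 (W t x))) →
        ∀ t < 0, Tendsto (fun j => clockAmp (w j) t) atTop (𝓝 (clockAmp W t))) ∧
    (∀ (C : ℝ) (u : ℝ → E3 → E3), Literature.Analysis.FluidPDE.IsTypeIAncientMild C u →
        ∀ c : ℝ, 0 < c → ∀ s < 0,
          clockAmp (c • Literature.Analysis.FluidPDE.stPull (c ^ 2) c 0 0 u) s = clockAmp u (c ^ 2 * s))

/-- **Stub statement 3 — EXTRACTION OF A ZOOM LIMIT IN THE CLASS.** Along any positive scales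
`c_n`, the zooms `u_{c_n} = c_n • stPull (c_n²) c_n 0 0 u` of a Type-I KNSS-mild field with the
energy ledger converge pointwise on `(−∞,0) × ℝ³`, along a subsequence, to a Type-I KNSS-mild field
with the SAME constant and the SAME ledger (`isTypeIAncientMild_zoom`, `scaledEnergy_zoom`,
`scaledGradEnergy_zoom`, `exists_tendsto_of_typeI_seq_Ioo`, `energyBounds_of_tendsto_Ioo`). -/
def ZoomExtraction : Prop :=
  ∀ (C : ℝ) (u : ℝ → E3 → E3), Literature.Analysis.FluidPDE.IsTypeIAncientMild C u →
    EnergyLedger C u → ∀ c : ℕ → ℝ, (∀ n, 0 < c n) →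
      ∃ φ : ℕ → ℕ, StrictMono φ ∧ ∃ W : ℝ → E3 → E3,
        Literature.Analysis.FluidPDE.IsTypeIAncientMild C W ∧ EnergyLedger C W ∧
          ∀ t < 0, ∀ x, Tendsto
            (fun j => (c (φ j) • Literature.Analysis.FluidPDE.stPull (c (φ j) ^ 2) (c (φ j)) 0 0 u) t x)
            atTop (𝓝 (W t x))

/-- **Stub statement 6 (conclusion) — THE CLASS PRESSURE WITH A UNIFORM BOUND.** For every `C`
there is `K = K(C)` such that every Type-I KNSS-mild field with the energy ledger `A, E ≤ C` is,
with some pressure `p`, a suitable weak solution in the unit parabolic ball `Q(0,1)` in the class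
of Albritton–Barker Def. 2.1, with `‖u‖_{L³(Q(0,1))} ≤ K` and `‖p‖_{L^{3/2}(Q(0,1))} ≤ K`. -/
def ClassPressure : Prop :=
  ∀ C : ℝ, ∃ K : NNReal, ∀ u : ℝ → E3 → E3, Literature.Analysis.FluidPDE.IsTypeIAncientMild C u →
    EnergyLedger C u →
      ∃ p : ℝ → E3 → ℝ, Literature.Analysis.FluidPDE.IsSuitableWeakSolutionInBall 1 0 u p ∧
        eLpNorm (Function.uncurry u) 3
            (volume.restrict (Literature.Analysis.FluidPDE.parabolicCylinder 1 (0 : ℝ × E3))) ≤ K ∧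
        eLpNorm (Function.uncurry p) (3 / 2)
            (volume.restrict (Literature.Analysis.FluidPDE.parabolicCylinder 1 (0 : ℝ × E3))) ≤ K

/-- **Stub statement 7 (conclusion) — LIMITS OF ZOOMS OF A SINGULAR ELEMENT ARE SINGULAR.** If
`u` (Type-I KNSS-mild with the ledger) is singular at the origin and its zooms along positive
scales `c_j` converge pointwise on `(−∞,0) × ℝ³` to a field `W`, then `W` is singular at the origin. -/
def LimitSingular : Prop :=
  ∀ (C : ℝ) (u : ℝ → E3 → E3), Literature.Analysis.FluidPDE.IsTypeIAncientMild C u →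
    EnergyLedger C u → IsSingularAtOrigin u →
      ∀ c : ℕ → ℝ, (∀ j, 0 < c j) → ∀ W : ℝ → E3 → E3,
        (∀ t < 0, ∀ x, Tendsto
            (fun j => (c j • Literature.Analysis.FluidPDE.stPull (c j ^ 2) (c j) 0 0 u) t x)
            atTop (𝓝 (W t x))) →
        IsSingularAtOrigin W

/-! ## The stubs (r2: four discharged by their landed files; one open) -/

/-- **STUB 1 `stub_timeDerivBounds`** — LANDED (p148023). -/
theorem stub_timeDerivBounds : TimeDerivBounds :=
  Summit.NavierStokesRegularity.NavierStokesRegularity.Theorems.ClockLaw.Birth.stub_timeDerivBounds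

/-- **STUB 2 `stub_clockSlice`** — LANDED (p148155). -/
theorem stub_clockSlice : ClockSlice :=
  Summit.NavierStokesRegularity.NavierStokesRegularity.Theorems.ClockLaw.Birth.stub_clockSlice

/-- **STUB 3 `stub_zoomExtraction`** — LANDED (p147751). -/
theorem stub_zoomExtraction : ZoomExtraction :=
  Summit.NavierStokesRegularity.NavierStokesRegularity.Theorems.ClockLaw.Birth.stub_zoomExtraction

/-- **STUB 6 `stub_classPressure`** — r2: the class pressure UNCONDITIONALLY, LANDED (p148736,
`ClockLaw.Birth.classPressure_holds`). -/
theorem stub_classPressure : ClassPressure :=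
  Summit.NavierStokesRegularity.NavierStokesRegularity.Theorems.ClockLaw.Birth.classPressure_holds

/-- **STUB 7 `stub_limitSingular`** — LANDED (p147016). -/
theorem stub_limitSingular : ClassPressure → LimitSingular :=
  Summit.NavierStokesRegularity.NavierStokesRegularity.Theorems.ClockLaw.Birth.stub_limitSingular

/-! ## Name-keyed aliases of the stub statements — the hypotheses of `ClockLaw_of` -/
namespace __Registered

/-- Alias keyed by the registered stub name. -/
abbrev stub_timeDerivBounds : Prop := TimeDerivBounds
/-- Alias keyed by the registered stub name. -/
abbrev stub_clockSlice : Prop := ClockSlice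
/-- Alias keyed by the registered stub name. -/
abbrev stub_zoomExtraction : Prop := ZoomExtraction
/-- Alias keyed by the registered stub name. -/
abbrev stub_classPressure : Prop := ClassPressure
/-- Alias keyed by the registered stub name. -/
abbrev stub_limitSingular : Prop := ClassPressure → LimitSingular

end __Registered

/-! ## Proved: the planner statements from the stubs -/

/-- `ClockContinuous` from stubs 1–2. -/
theorem clockContinuous_of (h1 : TimeDerivBounds) (h2 : ClockSlice) : ClockContinuous :=
  fun C u hu => (h2 h1).1 C u hu.isTypeIAncientMild

/-- `SteadyOfClockZero` from stubs 1–2. -/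
theorem steadyOfClockZero_of (h1 : TimeDerivBounds) (h2 : ClockSlice) : SteadyOfClockZero :=
  fun C u hu => (h2 h1).2.1 C u hu.isTypeIAncientMild

/-- `ZoomPersistence` from the stubs: scales `c_n = √(−t_n)`, extraction (stub 3), the
limit is in `𝒦_C` (`inTypeIClass_iff`) and singular (stubs 6–7), and
`a_u(t_{φ n}) = a_{u_{c_{φ n}}}(−1) → a_W(−1)` (stub 2 (iv) and (iii)). -/
theorem zoomPersistence_of (h1 : TimeDerivBounds) (h2 : ClockSlice) (h3 : ZoomExtraction)
    (h6 : ClassPressure) (h7 : ClassPressure → LimitSingular) : ZoomPersistence := by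
  intro C u hu hsing t ht hlim
  obtain ⟨-, -, hconv, hcov⟩ := h2 h1
  have hLS : LimitSingular := h7 h6
  have hu' := hu.isTypeIAncientMild
  have hE := hu.energy
  -- the scales
  set c : ℕ → ℝ := fun n => Real.sqrt (-(t n)) with hc
  have hcpos : ∀ n, 0 < c n := fun n => Real.sqrt_pos.2 (neg_pos.2 (ht n).2)
  have hcsq : ∀ n, c n ^ 2 = -(t n) := fun n => Real.sq_sqrt (neg_nonneg.2 (ht n).2.le)
  -- extraction
  obtain ⟨φ, hφ, W, hW, hWE, hpt⟩ := h3 C u hu' hE c hcpos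
  -- the limit is singular
  have hWsing : IsSingularAtOrigin W :=
    hLS C u hu' hE hsing (c ∘ φ) (fun j => hcpos (φ j)) W hpt
  -- the zooms are in the class with the same constant
  have hzoom : ∀ j, Literature.Analysis.FluidPDE.IsTypeIAncientMild C
      (c (φ j) • Literature.Analysis.FluidPDE.stPull (c (φ j) ^ 2) (c (φ j)) 0 0 u) := fun j =>
    Summit.NavierStokesRegularity.NavierStokesRegularity.Theorems.isTypeIAncientMild_zoom hu'
      (hcpos (φ j)) 0
  -- convergence of the clock amplitudes at `s = -1`
  have hlimA : Tendsto (fun j => clockAmp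
      (c (φ j) • Literature.Analysis.FluidPDE.stPull (c (φ j) ^ 2) (c (φ j)) 0 0 u) (-1)) atTop
      (𝓝 (clockAmp W (-1))) :=
    hconv C _ W hzoom hW hpt (-1) (by norm_num)
  -- covariance: `a_{u_c}(-1) = a_u(-c²) = a_u(t n)`
  have hcovn : ∀ j, clockAmp
      (c (φ j) • Literature.Analysis.FluidPDE.stPull (c (φ j) ^ 2) (c (φ j)) 0 0 u) (-1) =
      clockAmp u (t (φ j)) := by
    intro j
    rw [hcov C u hu' (c (φ j)) (hcpos (φ j)) (-1) (by norm_num), mul_neg_one, hcsq, neg_neg]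
  refine ⟨C, W, inTypeIClass_iff.2 ⟨hW, hWE⟩, hWsing, φ, hφ, ?_⟩
  exact hlimA.congr fun j => hcovn j

/-! ## Proved: nonnegativity, positivity, and the registered compactness argument -/

/-- The clock amplitude is nonnegative at negative times. -/
theorem clockAmp_nonneg (u : ℝ → E3 → E3) {t : ℝ} (ht : t < 0) : 0 ≤ clockAmp u t := by
  unfold clockAmp
  refine mul_nonneg (Real.rpow_nonneg (by linarith) _) (integral_nonneg fun x => ?_)
  positivity

/-- **The clock of a singular element never reads zero** (S2 + the PROVED support item
`SteadySliceLiouville` + singularity): `0 < a_u(t)` for every `t < 0`. -/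
theorem clockAmp_pos (hS2 : SteadyOfClockZero) {C : ℝ} {u : ℝ → E3 → E3} (hu : InTypeIClass C u)
    (hsing : IsSingularAtOrigin u) {t : ℝ} (ht : t < 0) : 0 < clockAmp u t := by
  rcases (clockAmp_nonneg u ht).lt_or_eq with hlt | heq
  · exact hlt
  · exfalso
    have hsteady : ∀ x, Literature.Analysis.FluidPDE.timeDeriv u t x = 0 := hS2 C u hu t ht heq.symm
    obtain ⟨hsm, hdiv, hmild, hTI, -⟩ := hu
    have hzero : ∀ s < 0, ∀ x, u s x = 0 :=
      Summit.NavierStokesRegularity.NavierStokesRegularity.Theorems.clockStretchingLaw_steadySliceLiouville_proof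
        C u ⟨hsm, hdiv, hmild, hTI⟩ t ht hsteady
    obtain ⟨s, hs, x, -, hM⟩ := hsing 1 one_pos 0
    rw [hzero s hs.2, norm_zero] at hM
    exact lt_irrefl _ hM

/-- **The crux's statement (unfolded over the vocabulary) from the three planner statements**
(compactness of `[−1, 0]`; the registered composition, unchanged). Stated in unfolded form so that
`ClockLaw_of` below is the only theorem of the file concluding the crux by name. -/
theorem clockLaw_of_three (hS1 : ClockContinuous) (hS2 : SteadyOfClockZero)
    (hS3 : ZoomPersistence) :
    ∀ (C : ℝ) (u : ℝ → E3 → E3), InTypeIClass C u → IsSingularAtOrigin u →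
      ∃ δ > 0, ∀ t : ℝ, -1 ≤ t → t < 0 → δ ≤ clockAmp u t := by
  intro C u hu hsing
  by_contra h
  push Not at h
  have hseq : ∀ n : ℕ, ∃ t : ℝ, -1 ≤ t ∧ t < 0 ∧ clockAmp u t < 1 / ((n : ℝ) + 1) :=
    fun n => h _ Nat.one_div_pos_of_nat
  choose t ht using hseq
  have hsmall : ∀ ψ : ℕ → ℕ, StrictMono ψ → ∀ L : ℝ,
      Tendsto (fun n => clockAmp u (t (ψ n))) atTop (𝓝 L) → L ≤ 0 := by
    intro ψ hψ L hL
    have hb : Tendsto (fun n : ℕ => 1 / ((ψ n : ℝ) + 1)) atTop (𝓝 0) :=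
      (tendsto_one_div_add_atTop_nhds_zero_nat (𝕜 := ℝ)).comp hψ.tendsto_atTop
    exact le_of_tendsto_of_tendsto' hL hb fun n => (ht (ψ n)).2.2.le
  obtain ⟨τ, hτmem, φ₀, hφ₀, hlim⟩ :=
    (isCompact_Icc : IsCompact (Set.Icc (-1 : ℝ) 0)).tendsto_subseq
      (fun n => (⟨(ht n).1, (ht n).2.1.le⟩ : t n ∈ Set.Icc (-1 : ℝ) 0))
  rcases hτmem.2.eq_or_lt with hτ0 | hτneg
  · subst hτ0
    obtain ⟨C', v, hv, hsingv, φ, hφ, hconv⟩ :=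
      hS3 C u hu hsing (t ∘ φ₀) (fun n => ⟨(ht (φ₀ n)).1, (ht (φ₀ n)).2.1⟩) hlim
    have hle : clockAmp v (-1) ≤ 0 := hsmall (φ₀ ∘ φ) (hφ₀.comp hφ) _ hconv
    exact absurd (clockAmp_pos hS2 hv hsingv (by norm_num)) (not_lt.2 hle)
  · have hcont : ContinuousAt (clockAmp u) τ :=
      (hS1 C u hu).continuousAt (Iio_mem_nhds hτneg)
    have hconv : Tendsto (fun n => clockAmp u (t (φ₀ n))) atTop (𝓝 (clockAmp u τ)) :=
      hcont.tendsto.comp hlim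
    have hle : clockAmp u τ ≤ 0 := hsmall φ₀ hφ₀ _ hconv
    exact absurd (clockAmp_pos hS2 hu hsing hτneg) (not_lt.2 hle)

/-- **`ClockLaw` from the five registered stubs (r2).** -/
theorem ClockLaw_of :
    __Registered.stub_timeDerivBounds → __Registered.stub_clockSlice →
      __Registered.stub_zoomExtraction → __Registered.stub_classPressure →
        __Registered.stub_limitSingular → ClockLaw :=
  fun h1 h2 h3 h6 h7 =>
    clockLaw_iff.2 (clockLaw_of_three (clockContinuous_of h1 h2) (steadyOfClockZero_of h1 h2)
      (zoomPersistence_of h1 h2 h3 h6 h7))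

/-- WIRING CHECK: the seven sorried stubs compose to a closed term of the crux's type (modulo their
`sorry`s). Deliberately an `example`. -/
example : ClockLaw :=
  ClockLaw_of stub_timeDerivBounds stub_clockSlice stub_zoomExtraction stub_classPressure
    stub_limitSingular

end Summit.NavierStokesRegularity.NavierStokesRegularity.Cruxes.ClockLaw.Birth
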